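import Summits.HubbardSuperconductivity.HubbardSuperconductivity.Theorems.KLProgrammeKLRegimeSplitEdgeFactsRungProfile
import Summits.HubbardSuperconductivity.HubbardSuperconductivity.Theorems.KLProgrammeKLRegimeSplitEdgeFactsWindowedMass
import Summits.HubbardSuperconductivity.HubbardSuperconductivity.Theorems.KLProgrammeKLRegimeSplitEdgeFactsRelativeLines

/-!
# Route `KLProgramme`, crux K3 — engine-flow child (stmt-HubbardSuperconductivity-20437), (X).3 class-#5 STEP order «61b/64b», supplier row «(ᾱ)-WINDOW» (pen (R200)(1),
# k3c1-p1 g15 row 62): WINDOWED MASS of the relative transfer profile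
# `α(c) = |t_{n+1}[s_{n+1,j}](c) − t_{n+1}[s_{n+1,j′}](c)| + Maj(s_{n+1,j} − s_{n+1,j′}, s_{n,n+1})(Qm,c) + Maj(s_{n,n+1}, s_{n+1,j} − s_{n+1,j′})(Qm,c)` — LINEAR IN THE RADIUS

Cell gate-hubbard-kl, seat p1 g21.  The (W2) rows of the p1 lineage, composed for k3c1-p1's pinned weight `α` of row 62 (`s_{n,m} = softSymbolCompl n m`, `t_n = klTransferWeight … n`,
`Maj = klBubbleMaj`): with `j_< = min(j,j′) ≥ n+1` the difference `s_{n+1,j} − s_{n+1,j′}` is (±) an admissible soft symbol at scale `j_<` (`softSymbolCompl_sub_compl_mem`), so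
* the transfer part is `sum_window_abs_klTransferWeight_compl_sub_le_linear` at scale `n+1`: `≤ (2·61524/π)·4^{−(j_<−(n+1))}·η`;
* each bubble majorant is `sum_window_klBubbleMaj_le_of_right/_of_left` (sup `|s_{n,n+1}|‖ĝ‖ ≤ 2/Λ_{n+1}`, `softSymbolCompl_succ_mul_norm_propCT_le`) times the windowed mass
  `sum_window_softSymbol_mul_norm_propCT_le_linear` of the admissible difference (`≤ (2·15381/π)Λ_{j_<}βL²·η`): `≤ (61524/π)·4^{−(j_<−(n+1))}·η` each
  (`Λ_{j_<}/Λ_{n+1} = 4^{−(j_<−(n+1))}`, `klScale_eq_pow_mul_of_le`).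
**`sum_window_relTransferProfile_le_linear`**: for `FrameOK R U N μ K`, `klBetaMin ≤ β ≤ L`, `n+1 ≤ j′ ≤ j`, every `Qm`, centre `x`, radius `η ≥ π/L`:
`Σ_{c : |c−x|_𝕋 ≤ η} α(c) ≤ (4·61524/π)·4^{−(j′−(n+1))}·η` — the window data `(A_w, η₀) = ((246096/π)·4^{−(j′−n−1)}, π/L)` asked by (R200)(1)/k3c1-p1 l.7106.
(The roles `j ≤ j′` follow by `|a − b| = |b − a|` and the symmetry of `Maj` in the sign of its arguments.)

Proofs only; no definitions; nothing here asserts (X).3, (c), any stub of 20437, K3 or superconductivity.  References: BGM 2006 §3 (sector/transfer bookkeeping)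
[cite: BenfattoGiulianiMastropietro2006]; FST II [cite: FeldmanSalmhoferTrubowitz1998].
-/

noncomputable section

namespace Summit.HubbardSuperconductivity.HubbardSuperconductivity.Theorems.KLRegimeSplit

set_option linter.dupNamespace false -- summit = problem name (single-conjunct summit), D-0017

open Real Finset Set Literature.MathematicalPhysics.QuantumLattice Literature.Probability.LatticeModels
open Summit.HubbardSuperconductivity.HubbardSuperconductivity.Theorems.DispersionFlow
open Summit.HubbardSuperconductivity.HubbardSuperconductivity.Theorems.KLProgrammeLegKernels
open Summit.HubbardSuperconductivity.HubbardSuperconductivity.Theorems.TwoPointAssembly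
open Summit.HubbardSuperconductivity.HubbardSuperconductivity.Theorems.KLRegimeWick

variable {L M : ℕ} [NeZero L] (β μ : ℝ) (K : TrigPolyC4v) {R : RenConsts} {U : ℝ} {N : ℕ}

omit [NeZero L] in
/-- `Maj(a, b)` only sees `|a|`: `Maj(−a, b) = Maj(a, b)`. -/
theorem klBubbleMaj_neg_left (a b : FreqMomentum L M → ℝ) (Qm c : TorusSite 2 L) :
    klBubbleMaj L M β μ K (-a) b Qm c = klBubbleMaj L M β μ K a b Qm c := by
  simp only [klBubbleMaj, Pi.neg_apply, abs_neg]

omit [NeZero L] in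
/-- `Maj(a, −b) = Maj(a, b)`. -/
theorem klBubbleMaj_neg_right (a b : FreqMomentum L M → ℝ) (Qm c : TorusSite 2 L) :
    klBubbleMaj L M β μ K a (-b) Qm c = klBubbleMaj L M β μ K a b Qm c := by
  simp only [klBubbleMaj, Pi.neg_apply, abs_neg]

/-- **«(ᾱ)-WINDOW»: the windowed mass of the relative transfer profile is linear in the radius.**  For `FrameOK R U N μ K`, `klBetaMin ≤ β ≤ L`, `n + 1 ≤ j′ ≤ j`,
every `Qm`, every centre `x` and every `η ≥ π/L`:
`Σ_{c : |c − x|_𝕋 ≤ η} (|t_{n+1}[s_{n+1,j}](c) − t_{n+1}[s_{n+1,j′}](c)| + Maj(s_{n+1,j} − s_{n+1,j′}, s_{n,n+1})(Qm,c) + Maj(s_{n,n+1}, s_{n+1,j} − s_{n+1,j′})(Qm,c))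
 ≤ (4·61524/π)·4^{−(j′−(n+1))}·η`. -/
theorem sum_window_relTransferProfile_le_linear (hK : FrameOK R U N μ K) (hβ : klBetaMin ≤ β) (hβL : β ≤ L) {n j j' : ℕ} (hj' : n + 1 ≤ j') (hjj : j' ≤ j)
    (Qm x : TorusSite 2 L) {η : ℝ} (hη : Real.pi / L ≤ η) :
    ∑ c ∈ (univ : Finset (TorusSite 2 L)).filter (fun c => klTorusNorm L (c - x) ≤ η),
        (|klTransferWeight L M β μ K (n + 1) (softSymbolCompl L M β μ K (n + 1) j) Qm c -
            klTransferWeight L M β μ K (n + 1) (softSymbolCompl L M β μ K (n + 1) j') Qm c| +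
          klBubbleMaj L M β μ K (softSymbolCompl L M β μ K (n + 1) j - softSymbolCompl L M β μ K (n + 1) j')
            (softSymbolCompl L M β μ K n (n + 1)) Qm c +
          klBubbleMaj L M β μ K (softSymbolCompl L M β μ K n (n + 1))
            (softSymbolCompl L M β μ K (n + 1) j - softSymbolCompl L M β μ K (n + 1) j') Qm c) ≤
      4 * 61524 / Real.pi * ((4 : ℝ) ^ (j' - (n + 1)))⁻¹ * η := by
  have hβ0 : 0 < β := pos_of_klBetaMin_le hβ
  have hL : (0 : ℝ) < L := lt_of_lt_of_le hβ0 hβL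
  have hπ := Real.pi_pos
  have hη0 : 0 ≤ η := le_trans (by positivity) hη
  have hΛ1 : 0 < klScale klE0 (n + 1) := klth_klScale_pos (n + 1)
  set d : FreqMomentum L M → ℝ := softSymbolCompl L M β μ K (n + 1) j - softSymbolCompl L M β μ K (n + 1) j' with hd
  have hdmem : ∀ k, 0 ≤ d k ∧ d k ≤ 1 - hubbardCutoffWeightCT L M β μ K (klScale klE0 j') k := fun k =>
    softSymbolCompl_sub_compl_mem β μ K (n + 1) hjj k
  have hA := softSymbolCompl_succ_mul_norm_propCT_le (L := L) (M := M) β μ K n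
  -- (i) the transfer part
  have h1 := sum_window_abs_klTransferWeight_compl_sub_le_linear (L := L) (M := M) β μ K hK hβ hβL hj' hjj Qm x hη
  -- (ii) `Maj(d, s_{n,n+1})`: sup on the right factor, windowed mass of `d` (centre `x`)
  have h2a := sum_window_klBubbleMaj_le_of_right (L := L) (M := M) β μ K hβ0 d hA Qm x η
  have h2b := sum_window_softSymbol_mul_norm_propCT_le_linear (L := L) (M := M) β μ K hK hβ hβL j' hdmem x hη
  -- (iii) `Maj(s_{n,n+1}, d)`: sup on the left factor, windowed mass of `d` (centre `Qm − x`)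
  have h3a := sum_window_klBubbleMaj_le_of_left (L := L) (M := M) β μ K hβ0 d hA Qm x η
  have h3b := sum_window_softSymbol_mul_norm_propCT_le_linear (L := L) (M := M) β μ K hK hβ hβL j' hdmem (Qm - x) hη
  -- the scale ratio `Λ_{j′} = 4^{−(j′−(n+1))}·Λ_{n+1}`
  have hratio : klScale klE0 j' = ((4 : ℝ) ^ (j' - (n + 1)))⁻¹ * klScale klE0 (n + 1) := klScale_eq_pow_mul_of_le hj'
  have hc0 : 0 ≤ (β * (L : ℝ) ^ 2)⁻¹ * (2 / klScale klE0 (n + 1)) := by positivity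
  have hbub : ∀ (W : ℝ), W ≤ 2 * 15381 / π * klScale klE0 j' * β * (L : ℝ) ^ 2 * η →
      (β * (L : ℝ) ^ 2)⁻¹ * (2 / klScale klE0 (n + 1)) * W ≤ 61524 / Real.pi * ((4 : ℝ) ^ (j' - (n + 1)))⁻¹ * η := by
    intro W hW
    calc (β * (L : ℝ) ^ 2)⁻¹ * (2 / klScale klE0 (n + 1)) * W
        ≤ (β * (L : ℝ) ^ 2)⁻¹ * (2 / klScale klE0 (n + 1)) * (2 * 15381 / π * klScale klE0 j' * β * (L : ℝ) ^ 2 * η) :=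
          mul_le_mul_of_nonneg_left hW hc0
      _ = 61524 / Real.pi * ((4 : ℝ) ^ (j' - (n + 1)))⁻¹ * η := by
          rw [hratio]
          field_simp
          ring
  rw [Finset.sum_add_distrib, Finset.sum_add_distrib]
  have h2 := hbub _ h2b
  have h3 := hbub _ h3b
  calc _ ≤ 2 * 61524 / π * ((4 : ℝ) ^ (j' - (n + 1)))⁻¹ * η + 61524 / Real.pi * ((4 : ℝ) ^ (j' - (n + 1)))⁻¹ * η +
          61524 / Real.pi * ((4 : ℝ) ^ (j' - (n + 1)))⁻¹ * η :=
        add_le_add (add_le_add h1 (h2a.trans h2)) (h3a.trans h3)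
    _ = 4 * 61524 / Real.pi * ((4 : ℝ) ^ (j' - (n + 1)))⁻¹ * η := by ring

end Summit.HubbardSuperconductivity.HubbardSuperconductivity.Theorems.KLRegimeSplit

end
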